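import Mathlib
import Literature.Topology.PlaneTopology.WindingNumber
import HarnessLib

/-!
# Pellet's theorem: counting the roots of a polynomial in a disc

Topic: Analysis / Complex (`Literature/Analysis/Complex/`).

For `p ∈ ℂ[X]`, a centre `c ∈ ℂ`, a radius `r > 0` and an index `m`, write
`b k := (taylor c p).coeff k = p⁽ᵏ⁾(c) / k!` for the Taylor coefficients of `p` at `c`
(Mathlib: `Polynomial.taylor_coeff`, `(taylor c p).coeff k = (hasseDeriv k p).eval c`).
**Pellet's test** at `(c, r, m)` is the single strict inequality

  `∑_{k ≠ m} ‖b k‖ · r ^ k < ‖b m‖ · r ^ m`,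

and **Pellet's theorem** (A. E. Pellet 1881 [Pellet1881]; Borwein–Erdélyi
[BorweinErdelyi1995, §1.2 E.5]; Becker–Sagraloff–Sharma–Yap [BeckerEtAl2018, §3.1 Thm. 1], whose
`T_m(c, r, K, p)` with `K ≥ 1` is this inequality with the left side multiplied by `K`) says that
it forces `p` to have **no zero on the circle** `‖z - c‖ = r` and **exactly `m` zeros, counted
with multiplicity, in the open disc** `‖z - c‖ < r` (`pellet`). The proof is Rouché's: on the
circle the dominant term `b m · (z - c) ^ m` beats the rest of the Taylor expansion, so along the
circle `γ = circleLoop c r` the loops `p ∘ γ` and `b m · (γ - c) ^ m` have the same winding number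
about `0`, namely `m`; and the winding number of `p ∘ γ` counts the roots inside.

Contents:
* `wind_eval_circleLoop` — the **argument principle for polynomials on circles**: if no root of
  `p ≠ 0` lies on the circle, `t ↦ p (γ t)` is a loop in `ℂ \ {0}` whose winding number is the
  number of roots of `p` in the open disc [BorweinErdelyi1995, §1.2 E.3 b];
* `card_roots_eq_of_norm_sub_lt` — **Rouché's theorem for polynomials on circles**
  [BorweinErdelyi1995, §1.2 E.3 c];
* `pellet`; `pellet_hasseDeriv` (the `T_k(m, r, K, F)` form, [BeckerEtAl2018, §3.1 Def. 1]);
  the extreme cases `pellet_zero` (`m = 0`: a root-free closed disc) and `pellet_natDegree`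
  (`m = deg p`: all roots inside — the Rouché step in the proof of Cauchy's bound
  [BorweinErdelyi1995, Thm. 1.2.1]; Mathlib has the bound itself as
  `Polynomial.IsRoot.norm_lt_cauchyBound`), and `pellet_one` (`m = 1`: an isolating disc for a
  simple root);
* `pellet_of_bounds` — the test survives replacing `‖b k‖ (k ≠ m)` by upper bounds and `‖b m‖` by
  a lower bound: the certified branch `E_ℓ⁻ > E_r⁺ ⇒ True` of the soft comparison
  [BeckerEtAl2018, §3.3 Algorithm 1]; `norm_mem_Icc_of_normSq_eq` supplies such bounds for a
  coefficient of known rational `‖b‖²` from one integer square root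
  [BrentZimmermann2010, §1.5.1 Algorithm 1.13];
* `roots_map_conj`, `exists_real_root_of_card_eq_one` — for a real polynomial the roots are closed
  under conjugation [BorweinErdelyi1995, §1.1 E.8], so a disc with real centre certified to
  contain exactly one root contains a real root;
* `roots_covered_of_separated` — completeness by pigeonhole: `deg p` pairwise separated discs
  each containing a root of `p ≠ 0` contain all the roots, exactly one each (fundamental theorem
  of algebra, `deg p` roots with multiplicity [BorweinErdelyi1995, Thm. 1.2.1]);
* the companion file `PelletTaylorShift.lean` adds the **complete Horner scheme** (repeated
  synthetic division by `X - c`) computing the Taylor coefficients `b k` from a coefficient list,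
  and Pellet's test run on its output.

Dictionary with the certified root isolator `cap.roots.pellet` (engines `cap` 0.2.24), whose
soundness this file records: `_shift_coeffs(p, c)[k]` ↦ `(taylor c p).coeff k` (the loop itself
is `taylorShift` of `PelletTaylorShift.lean`); the exact rational test
`pellet_exact(p, c, r, m)` ↦ `pellet_of_bounds` (and `pellet_taylorShift` there), its
`_sqrt_lower` / `_sqrt_upper` (`isqrt(N·D·4^S)`, `+1` unless a perfect square, over `D·2^S`) ↦
`norm_mem_Icc_of_normSq_eq`; isolating discs (`m = 1` on the square-free part) ↦ `pellet_one`;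
the final separation-and-count check (`|cᵢ - cⱼ|² > (rᵢ + rⱼ)²`, `#discs = deg`) ↦
`roots_covered_of_separated`; real-root tagging (real input, real centre, one root) ↦
`exists_real_root_of_card_eq_one`. The interval re-evaluation of the same inequality
("implementation B", outward-rounded `mpmath.iv`) is not formalised separately: it certifies the
hypothesis of `pellet_of_bounds`. Early exits of `pellet_exact` only ever answer "no claim".

Design: root counts are the explicit multiset cardinalities
`Multiset.card (p.roots.filter fun ζ => ‖ζ - c‖ < r)` (no new definitions); winding numbers are
the topological ones of `Literature.Topology.PlaneTopology.WindingNumber` (`wind`, `circleLoop`,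
`wind_eq_of_norm_sub_lt`), so no contour integrals appear. Not here: the annulus formulation of
Pellet's theorem via the two positive zeros `s₁ < s₂` of the auxiliary real polynomial (we state
the test at one radius, which is what is checked in practice, and is the content of the proof in
[BorweinErdelyi1995, §1.2 E.5]), the converse direction, the Graeffe-accelerated and soft
versions of the test [BeckerEtAl2018, §3.2–3.3], and all complexity statements.

## References
* [Pellet1881] A. E. Pellet, Sur un mode de séparation des racines des équations et la formule
  de Lagrange, Bull. Sci. Math. Astron. (2) 5 (1881) 393–395.
* [BorweinErdelyi1995] P. Borwein, T. Erdélyi, *Polynomials and Polynomial Inequalities*,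
  GTM 161, Springer (1995): §1.1 E.8; §1.2 Thm. 1.2.1, E.3 b–c, E.5.
* [BeckerEtAl2018] R. Becker, M. Sagraloff, V. Sharma, C. Yap, A near-optimal subdivision
  algorithm for complex root isolation based on the Pellet test and Newton iteration,
  J. Symb. Comput. 86 (2018) 51–96 (arXiv:1509.06231): §3.1 Def. 1, Thm. 1; §3.3 Algorithm 1.
* [BrentZimmermann2010] R. P. Brent, P. Zimmermann, *Modern Computer Arithmetic*, CUP (2010),
  §1.5.1 (`SqrtRem`, `SqrtInt`).
-/

noncomputable section

open _root_.Polynomial Set Finset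
open Literature.Topology.PlaneTopology

namespace Literature.Analysis.Complex.Pellet

/-! ### The argument principle and Rouché's theorem for polynomials on circles -/

section ArgumentPrinciple

variable {r : ℝ}

/-- For a point `ζ` off the circle `‖z - c‖ = r` (`0 ≤ r`), `t ↦ circleLoop c r t - ζ` is a loop
in `ℂ \ {0}`. [folklore] -/
private theorem isNonvanishingLoop_circleLoop_sub (c ζ : ℂ) (hr : 0 ≤ r) (h : ‖ζ - c‖ ≠ r) :
    IsNonvanishingLoop (fun t => circleLoop c r t - ζ) := by
  have h' : ‖c - ζ‖ ≠ |r| := by rwa [abs_of_nonneg hr, norm_sub_rev]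
  exact (isNonvanishingLoop_circleLoop h').congr fun t _ => (circleLoop_sub c ζ r t).symm

/-- The winding number of the circle `‖z - c‖ = r` about a point `ζ` off it is `1` if
`‖ζ - c‖ < r` and `0` if `‖ζ - c‖ > r`. [folklore] -/
private theorem wind_circleLoop_sub_eq_ite (c ζ : ℂ) (hr : 0 ≤ r) (h : ‖ζ - c‖ ≠ r) :
    wind (fun t => circleLoop c r t - ζ) = if ‖ζ - c‖ < r then 1 else 0 := by
  split_ifs with hlt
  · exact wind_circleLoop_sub_of_norm_lt hlt
  · exact wind_circleLoop_sub_of_lt_norm hr (lt_of_le_of_ne (not_lt.1 hlt) (Ne.symm h))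

/-- Winding number of `t ↦ a · ∏_{ζ ∈ s} (γ t - ζ)` along the circle `γ = circleLoop c r`, for a
multiset `s` of points off the circle and `a ≠ 0`: the number of points of `s` inside the
circle, counted with multiplicity. [folklore] -/
private theorem wind_const_mul_prod {a : ℂ} (ha : a ≠ 0) (c : ℂ) (hr : 0 ≤ r) (s : Multiset ℂ)
    (hs : ∀ ζ ∈ s, ‖ζ - c‖ ≠ r) :
    IsNonvanishingLoop (fun t => a * (s.map fun ζ => circleLoop c r t - ζ).prod) ∧
      wind (fun t => a * (s.map fun ζ => circleLoop c r t - ζ).prod) =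
        Multiset.card (s.filter fun ζ => ‖ζ - c‖ < r) := by
  induction s using Multiset.induction_on with
  | empty => simpa using And.intro (IsNonvanishingLoop.const ha) (wind_const a)
  | cons ζ s ih =>
    obtain ⟨ih₁, ih₂⟩ := ih fun ξ hξ => hs ξ (Multiset.mem_cons_of_mem hξ)
    have hζ : ‖ζ - c‖ ≠ r := hs ζ (Multiset.mem_cons_self ζ s)
    have hl := isNonvanishingLoop_circleLoop_sub c ζ hr hζ
    have key : (fun t => a * ((ζ ::ₘ s).map fun ξ => circleLoop c r t - ξ).prod) =
        fun t => (circleLoop c r t - ζ) * (a * (s.map fun ξ => circleLoop c r t - ξ).prod) := by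
      funext t
      rw [Multiset.map_cons, Multiset.prod_cons]
      ring
    rw [key, wind_mul hl ih₁, ih₂, wind_circleLoop_sub_eq_ite c ζ hr hζ]
    refine ⟨hl.mul ih₁, ?_⟩
    by_cases hlt : ‖ζ - c‖ < r
    · rw [if_pos hlt, Multiset.filter_cons_of_pos (p := fun ξ => ‖ξ - c‖ < r) s hlt,
        Multiset.card_cons]
      push_cast
      ring
    · rw [if_neg hlt, Multiset.filter_cons_of_neg (p := fun ξ => ‖ξ - c‖ < r) s hlt, zero_add]

/-- **The argument principle for polynomials on circles.** Let `p ∈ ℂ[X]`, `p ≠ 0`, and let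
`γ(t) = c + r e^{2πit}` (`r ≥ 0`) be a circle avoiding the roots of `p`. Then `t ↦ p(γ(t))` is a
loop in `ℂ \ {0}` and its winding number about `0` — classically `(2πi)⁻¹ ∮_γ p'/p` — equals the
number of roots of `p` in the open disc `‖z - c‖ < r`, counted with multiplicity. Proof: factor
`p = aₙ ∏ (X - αᵢ)` over `ℂ` and add up the winding numbers of the factors (`1` for a root
inside, `0` for a root outside). [cite: BorweinErdelyi1995, §1.2 E.3 b] -/
theorem wind_eval_circleLoop {p : ℂ[X]} (hp : p ≠ 0) (c : ℂ) (hr : 0 ≤ r)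
    (hroots : ∀ ζ ∈ p.roots, ‖ζ - c‖ ≠ r) :
    IsNonvanishingLoop (fun t => p.eval (circleLoop c r t)) ∧
      wind (fun t => p.eval (circleLoop c r t)) =
        Multiset.card (p.roots.filter fun ζ => ‖ζ - c‖ < r) := by
  have key : (fun t => p.eval (circleLoop c r t)) =
      fun t => p.leadingCoeff * (p.roots.map fun ζ => circleLoop c r t - ζ).prod := by
    funext t
    conv_lhs => rw [← C_leadingCoeff_mul_prod_multiset_X_sub_C
      (IsAlgClosed.card_roots_eq_natDegree (p := p))]
    rw [eval_mul, eval_C, eval_multiset_prod, Multiset.map_map]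
    simp only [Function.comp_def, eval_sub, eval_X, eval_C]
  rw [key]
  exact wind_const_mul_prod (leadingCoeff_ne_zero.2 hp) c hr p.roots hroots

/-- **Rouché's theorem for polynomials on circles.** If `‖q(z) - p(z)‖ < ‖p(z)‖` on the circle
`‖z - c‖ = r` (`r > 0`), then `p` and `q` have the same number of roots, counted with
multiplicity, in the open disc `‖z - c‖ < r` (and neither vanishes on the circle). Proof: the
strict inequality makes both `p ∘ γ` and `q ∘ γ` loops in `ℂ \ {0}` with equal winding numbers
(`wind_eq_of_norm_sub_lt`), and these count the roots (`wind_eval_circleLoop`).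
[cite: BorweinErdelyi1995, §1.2 E.3 c] -/
theorem card_roots_eq_of_norm_sub_lt {p q : ℂ[X]} (c : ℂ) (hr : 0 < r)
    (h : ∀ z : ℂ, ‖z - c‖ = r → ‖q.eval z - p.eval z‖ < ‖p.eval z‖) :
    Multiset.card (q.roots.filter fun ζ => ‖ζ - c‖ < r) =
      Multiset.card (p.roots.filter fun ζ => ‖ζ - c‖ < r) := by
  have hcirc : ∀ t : ℝ, ‖circleLoop c r t - c‖ = r := fun t => by
    rw [norm_circleLoop_sub_center, abs_of_pos hr]
  have hp0 : ∀ z, ‖z - c‖ = r → p.eval z ≠ 0 := fun z hz h0 => by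
    have := h z hz
    rw [h0, norm_zero] at this
    exact (not_lt.2 (norm_nonneg _)) this
  have hq0 : ∀ z, ‖z - c‖ = r → q.eval z ≠ 0 := fun z hz h0 => by
    have := h z hz
    rw [h0, zero_sub, norm_neg] at this
    exact lt_irrefl _ this
  have hp : p ≠ 0 := fun h0 => hp0 _ (hcirc 0) (by rw [h0, eval_zero])
  have hq : q ≠ 0 := fun h0 => hq0 _ (hcirc 0) (by rw [h0, eval_zero])
  obtain ⟨hpl, hpw⟩ := wind_eval_circleLoop hp c hr.le
    fun ζ hζ hζr => hp0 ζ hζr ((mem_roots hp).1 hζ)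
  obtain ⟨hql, hqw⟩ := wind_eval_circleLoop hq c hr.le
    fun ζ hζ hζr => hq0 ζ hζr ((mem_roots hq).1 hζ)
  have := wind_eq_of_norm_sub_lt hql.continuousOn hql.eq_endpoints hpl fun t _ => h _ (hcirc t)
  rw [hpw, hqw] at this
  exact_mod_cast this

end ArgumentPrinciple

/-! ### Pellet's theorem -/

section Pellet

variable {p : ℂ[X]} {c : ℂ} {r : ℝ} {m N : ℕ}

/-- On the circle `‖z - c‖ = r` the Taylor expansion of `p` at `c` minus its `m`-th term is
bounded by the off-`m` part of Pellet's sum. [folklore] -/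
private theorem norm_eval_sub_le (hN : p.natDegree < N) (hm : m < N) {z : ℂ}
    (hz : ‖z - c‖ = r) :
    ‖p.eval z - (taylor c p).coeff m * (z - c) ^ m‖ ≤
      ∑ k ∈ (range N).erase m, ‖(taylor c p).coeff k‖ * r ^ k := by
  have hexp : p.eval z = ∑ k ∈ range N, (taylor c p).coeff k * (z - c) ^ k := by
    rw [← taylor_eval_sub c p z,
      eval_eq_sum_range' (lt_of_eq_of_lt (natDegree_taylor p c) hN)]
  rw [hexp, ← add_sum_erase (range N) _ (mem_range.2 hm), add_sub_cancel_left]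
  refine (norm_sum_le _ _).trans (le_of_eq (sum_congr rfl fun k _ => ?_))
  rw [norm_mul, norm_pow, hz]

/-- **Pellet's theorem** (one-radius form). Let `p ∈ ℂ[X]` with `deg p < N`, `r > 0`, and
`b k = (taylor c p).coeff k = p⁽ᵏ⁾(c)/k!`. If
`∑_{k < N, k ≠ m} ‖b k‖ r^k < ‖b m‖ r^m`, then `p` has no zero on the circle `‖z - c‖ = r` and
exactly `m` zeros, counted with multiplicity, in the open disc `‖z - c‖ < r`. (Pellet 1881
[Pellet1881]; [BorweinErdelyi1995, §1.2 E.5], where the hypothesis is `g(r) < 0` for the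
auxiliary polynomial `g(x) = ∑_{k ≠ m} ‖b k‖ x^k - ‖b m‖ x^m`; this is the `K = 1` case of the
`T_m`-test.) Proof: Rouché against `b m (z - c)^m`, whose winding number along the circle is `m`.
[cite: BeckerEtAl2018, §3.1 Thm. 1] -/
theorem pellet (hr : 0 < r) (hN : p.natDegree < N)
    (hP : ∑ k ∈ (range N).erase m, ‖(taylor c p).coeff k‖ * r ^ k <
      ‖(taylor c p).coeff m‖ * r ^ m) :
    (∀ z : ℂ, ‖z - c‖ = r → p.eval z ≠ 0) ∧
      Multiset.card (p.roots.filter fun ζ => ‖ζ - c‖ < r) = m := by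
  have hsum : 0 ≤ ∑ k ∈ (range N).erase m, ‖(taylor c p).coeff k‖ * r ^ k :=
    sum_nonneg fun k _ => by positivity
  have hbm : (taylor c p).coeff m ≠ 0 := fun h0 => by
    rw [h0, norm_zero, zero_mul] at hP
    exact (not_lt.2 hsum) hP
  have hmN : m < N :=
    lt_of_le_of_lt ((le_natDegree_of_ne_zero hbm).trans_eq (natDegree_taylor p c)) hN
  have hp : p ≠ 0 := fun h0 => hbm (by rw [h0, map_zero, coeff_zero])
  have hest : ∀ z : ℂ, ‖z - c‖ = r →
      ‖p.eval z - (taylor c p).coeff m * (z - c) ^ m‖ <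
        ‖(taylor c p).coeff m * (z - c) ^ m‖ := fun z hz =>
    calc ‖p.eval z - (taylor c p).coeff m * (z - c) ^ m‖
        ≤ ∑ k ∈ (range N).erase m, ‖(taylor c p).coeff k‖ * r ^ k := norm_eval_sub_le hN hmN hz
      _ < ‖(taylor c p).coeff m‖ * r ^ m := hP
      _ = ‖(taylor c p).coeff m * (z - c) ^ m‖ := by rw [norm_mul, norm_pow, hz]
  have hne : ∀ z : ℂ, ‖z - c‖ = r → p.eval z ≠ 0 := fun z hz h0 => by
    have := hest z hz
    rw [h0, zero_sub, norm_neg] at this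
    exact lt_irrefl _ this
  refine ⟨hne, ?_⟩
  obtain ⟨hl, hw⟩ := wind_eval_circleLoop hp c hr.le
    fun ζ hζ hζr => hne ζ hζr ((mem_roots hp).1 hζ)
  have hcirc : ∀ t : ℝ, ‖circleLoop c r t - c‖ = r := fun t => by
    rw [norm_circleLoop_sub_center, abs_of_pos hr]
  have h0 : IsNonvanishingLoop (circleLoop 0 r) :=
    isNonvanishingLoop_circleLoop (by rw [norm_zero, abs_of_pos hr]; exact hr.ne)
  have e : (fun t => (taylor c p).coeff m * (circleLoop c r t - c) ^ m) =
      fun t => (taylor c p).coeff m * circleLoop 0 r t ^ (m : ℤ) := by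
    funext t
    rw [zpow_natCast, circleLoop_sub, sub_self]
  have hg : IsNonvanishingLoop fun t => (taylor c p).coeff m * (circleLoop c r t - c) ^ m := by
    rw [e]
    exact (IsNonvanishingLoop.const hbm).mul (h0.zpow m)
  have hwg : wind (fun t => (taylor c p).coeff m * (circleLoop c r t - c) ^ m) = m := by
    rw [e, wind_mul (IsNonvanishingLoop.const hbm) (h0.zpow m), wind_const, wind_zpow h0,
      wind_circleLoop_zero hr, zero_add, mul_one]
  have := wind_eq_of_norm_sub_lt hl.continuousOn hl.eq_endpoints hg fun t _ => hest _ (hcirc t)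
  rw [hw, hwg] at this
  exact_mod_cast this

/-- **The `T_k`-test** of Becker–Sagraloff–Sharma–Yap: for `K ≥ 1`,
`T_m(c, r, K, p) : ‖p⁽ᵐ⁾(c) r^m / m!‖ > K · ∑_{i ≠ m} ‖p⁽ⁱ⁾(c) r^i / i!‖` implies that the open disc
`Δ(c, r)` contains exactly `m` roots of `p` counted with multiplicity (and none lies on its
boundary). Here `p⁽ⁱ⁾(c)/i! = (hasseDeriv i p).eval c`.
[cite: BeckerEtAl2018, §3.1 Def. 1, Thm. 1] -/
theorem pellet_hasseDeriv (hr : 0 < r) (hN : p.natDegree < N) {K : ℝ} (hK : 1 ≤ K)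
    (hT : K * ∑ i ∈ (range N).erase m, ‖(hasseDeriv i p).eval c‖ * r ^ i <
      ‖(hasseDeriv m p).eval c‖ * r ^ m) :
    (∀ z : ℂ, ‖z - c‖ = r → p.eval z ≠ 0) ∧
      Multiset.card (p.roots.filter fun ζ => ‖ζ - c‖ < r) = m := by
  have hS : 0 ≤ ∑ i ∈ (range N).erase m, ‖(hasseDeriv i p).eval c‖ * r ^ i :=
    sum_nonneg fun i _ => by positivity
  apply pellet hr hN
  simp only [taylor_coeff]
  calc ∑ i ∈ (range N).erase m, ‖(hasseDeriv i p).eval c‖ * r ^ i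
      ≤ K * ∑ i ∈ (range N).erase m, ‖(hasseDeriv i p).eval c‖ * r ^ i :=
        le_mul_of_one_le_left hS hK
    _ < ‖(hasseDeriv m p).eval c‖ * r ^ m := hT

/-- **Pellet's test with bounds in place of the coefficients** (what an implementation checks):
if `‖b k‖ ≤ u k` for `k ≠ m`, `ℓ ≤ ‖b m‖`, and `∑_{k ≠ m} u k · r^k < ℓ · r^m`, then the conclusion
of Pellet's theorem holds. This is the certified branch "`E_ℓ⁻ > E_r⁺ ⇒ True`" of the soft
comparison of `E_ℓ = ‖b m‖ r^m` with `E_r = ∑_{k ≠ m} ‖b k‖ r^k` from approximations with known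
error. [cite: BeckerEtAl2018, §3.3 Algorithm 1] -/
theorem pellet_of_bounds (hr : 0 < r) (hN : p.natDegree < N) (u : ℕ → ℝ) (ℓ : ℝ)
    (hu : ∀ k ∈ (range N).erase m, ‖(taylor c p).coeff k‖ ≤ u k)
    (hℓ : ℓ ≤ ‖(taylor c p).coeff m‖)
    (h : ∑ k ∈ (range N).erase m, u k * r ^ k < ℓ * r ^ m) :
    (∀ z : ℂ, ‖z - c‖ = r → p.eval z ≠ 0) ∧
      Multiset.card (p.roots.filter fun ζ => ‖ζ - c‖ < r) = m :=
  pellet hr hN <|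
    calc ∑ k ∈ (range N).erase m, ‖(taylor c p).coeff k‖ * r ^ k
        ≤ ∑ k ∈ (range N).erase m, u k * r ^ k :=
          sum_le_sum fun k hk => mul_le_mul_of_nonneg_right (hu k hk) (pow_nonneg hr.le k)
      _ < ℓ * r ^ m := h
      _ ≤ ‖(taylor c p).coeff m‖ * r ^ m := mul_le_mul_of_nonneg_right hℓ (pow_nonneg hr.le m)

/-- **Pellet's test with `m = 0`: an exclusion disc.** If `∑_{0 < k < N} ‖b k‖ r^k < ‖p(c)‖`
(`deg p < N`, `r > 0`), then `p` has no zero in the closed disc `‖z - c‖ ≤ r` — the `T_0`-test.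
[cite: BeckerEtAl2018, §3.1 Thm. 1] -/
theorem pellet_zero (hr : 0 < r) (hN : p.natDegree < N)
    (hP : ∑ k ∈ (range N).erase 0, ‖(taylor c p).coeff k‖ * r ^ k < ‖p.eval c‖) :
    ∀ z : ℂ, ‖z - c‖ ≤ r → p.eval z ≠ 0 := by
  obtain ⟨hne, hcard⟩ := pellet (m := 0) hr hN (by rwa [taylor_coeff_zero, pow_zero, mul_one])
  have hp : p ≠ 0 := by
    rintro rfl
    exact hne (c + r) (by simp [abs_of_pos hr]) eval_zero
  intro z hz
  rcases hz.lt_or_eq with hlt | heq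
  · intro h0
    have hmem : z ∈ p.roots.filter fun ζ => ‖ζ - c‖ < r :=
      Multiset.mem_filter.2 ⟨(mem_roots hp).2 h0, hlt⟩
    rw [Multiset.card_eq_zero.1 hcard] at hmem
    exact Multiset.notMem_zero _ hmem
  · exact hne z heq

/-- **Pellet's test with `m = deg p`: an inclusion disc.** If
`∑_{k < deg p} ‖b k‖ r^k < ‖lead p‖ r^{deg p}` (`r > 0`), then every root of `p` lies in the open
disc `‖z - c‖ < r` (and there are `deg p` of them with multiplicity,
`IsAlgClosed.card_roots_eq_natDegree`). With `c = 0` this is the Rouché step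
`|p(z) - aₙ zⁿ| < |aₙ zⁿ|` in the proof of Cauchy's bound.
[cite: BorweinErdelyi1995, §1.2 Thm. 1.2.1] -/
theorem pellet_natDegree (hr : 0 < r)
    (hP : ∑ k ∈ range p.natDegree, ‖(taylor c p).coeff k‖ * r ^ k <
      ‖p.leadingCoeff‖ * r ^ p.natDegree) :
    ∀ ζ ∈ p.roots, ‖ζ - c‖ < r := by
  have h := pellet (m := p.natDegree) (N := p.natDegree + 1) hr (Nat.lt_succ_self _)
    (by rwa [range_add_one, erase_insert notMem_range_self, coeff_taylor_natDegree])
  have hall : (p.roots.filter fun ζ => ‖ζ - c‖ < r) = p.roots :=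
    Multiset.eq_of_le_of_card_le (Multiset.filter_le _ _)
      (by rw [h.2]; exact IsAlgClosed.card_roots_eq_natDegree.le)
  intro ζ hζ
  rw [← hall] at hζ
  exact (Multiset.mem_filter.1 hζ).2

/-- **Pellet's test with `m = 1`: an isolating disc.** If `∑_{k < N, k ≠ 1} ‖b k‖ r^k < ‖p'(c)‖ r`
(`deg p < N`, `r > 0`), then the closed disc `‖z - c‖ ≤ r` contains exactly one root `ζ` of `p`,
it lies in the open disc, and it is simple. This is the certificate an isolating-disc algorithm
outputs for each root of a square-free polynomial. [cite: BeckerEtAl2018, §3.1 Thm. 1] -/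
theorem pellet_one (hr : 0 < r) (hN : p.natDegree < N)
    (hP : ∑ k ∈ (range N).erase 1, ‖(taylor c p).coeff k‖ * r ^ k < ‖p.derivative.eval c‖ * r) :
    ∃ ζ : ℂ, ‖ζ - c‖ < r ∧ p.IsRoot ζ ∧ p.rootMultiplicity ζ = 1 ∧
      ∀ z : ℂ, ‖z - c‖ ≤ r → p.IsRoot z → z = ζ := by
  classical
  obtain ⟨hne, hcard⟩ := pellet (m := 1) hr hN (by rwa [taylor_coeff_one, pow_one])
  have hp : p ≠ 0 := by
    rintro rfl
    exact hne (c + r) (by simp [abs_of_pos hr]) eval_zero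
  obtain ⟨ζ, hζ⟩ := Multiset.card_eq_one.1 hcard
  have hmem : ζ ∈ p.roots.filter fun ξ => ‖ξ - c‖ < r := by
    rw [hζ]
    exact Multiset.mem_singleton_self ζ
  obtain ⟨hζroot, hζlt⟩ := Multiset.mem_filter.1 hmem
  refine ⟨ζ, hζlt, (mem_roots hp).1 hζroot, ?_, fun z hz hroot => ?_⟩
  · have := Multiset.count_filter_of_pos (p := fun ξ => ‖ξ - c‖ < r) (s := p.roots) (a := ζ) hζlt
    rw [hζ, Multiset.count_singleton_self, count_roots] at this
    exact this.symm
  · rcases hz.lt_or_eq with hlt | heq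
    · have hz' : z ∈ p.roots.filter fun ξ => ‖ξ - c‖ < r :=
        Multiset.mem_filter.2 ⟨(mem_roots hp).2 hroot, hlt⟩
      rw [hζ] at hz'
      exact Multiset.mem_singleton.1 hz'
    · exact ((hne z heq) hroot).elim

end Pellet

/-! ### Exact evaluation: coefficient norms from one integer square root -/

section Sqrt

/-- `√(N/D) = √(N·D·4^S) / (D·2^S)` for naturals `N, D, S` with `D > 0`. [folklore] -/
private theorem sqrt_div_eq (N D S : ℕ) (hD : 0 < D) :
    √((N : ℝ) / D) = √((N * D * 4 ^ S : ℕ) : ℝ) / (D * 2 ^ S) := by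
  have hD' : (0 : ℝ) < D := by exact_mod_cast hD
  have hpos : (0 : ℝ) < D * 2 ^ S := by positivity
  rw [eq_div_iff hpos.ne']
  have h4 : (4 : ℝ) ^ S = (2 ^ S) ^ 2 := by
    rw [← pow_mul, mul_comm, pow_mul]
    norm_num
  have : ((N * D * 4 ^ S : ℕ) : ℝ) = (N : ℝ) / D * ((D : ℝ) * 2 ^ S) ^ 2 := by
    push_cast
    rw [h4]
    field_simp
  rw [this, Real.sqrt_mul (by positivity), Real.sqrt_sq hpos.le]

/-- **Enclosing `‖b‖` from one integer square root.** If `‖b‖² = normSq b = N/D` exactly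
(`N, D ∈ ℕ`, `D > 0`; e.g. `b` a Gaussian rational) and `s = ⌊√(N·D·4^S)⌋` is the integer square
root — `s² ≤ N·D·4^S < (s+1)²`, the output specification of `SqrtInt` / `SqrtRem` — then
`s / (D·2^S) ≤ ‖b‖ ≤ (s + 1) / (D·2^S)`, and `‖b‖ = s / (D·2^S)` when `N·D·4^S` is a perfect
square. (Mathlib's `Nat.sqrt` is `⌊√·⌋`: `Nat.sqrt_le'`, `Nat.lt_succ_sqrt'`.)
[cite: BrentZimmermann2010, §1.5.1 Algorithm 1.13] -/
theorem norm_mem_Icc_of_normSq_eq {b : ℂ} {N D : ℕ} (S : ℕ) (hD : 0 < D)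
    (hb : Complex.normSq b = (N : ℝ) / D) :
    (Nat.sqrt (N * D * 4 ^ S) : ℝ) / (D * 2 ^ S) ≤ ‖b‖ ∧
      ‖b‖ ≤ ((Nat.sqrt (N * D * 4 ^ S) : ℝ) + 1) / (D * 2 ^ S) ∧
      (Nat.sqrt (N * D * 4 ^ S) ^ 2 = N * D * 4 ^ S →
        ‖b‖ = (Nat.sqrt (N * D * 4 ^ S) : ℝ) / (D * 2 ^ S)) := by
  set M : ℕ := N * D * 4 ^ S with hM
  have hnorm : ‖b‖ = √(M : ℝ) / (D * 2 ^ S) := by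
    rw [Complex.norm_def, hb, sqrt_div_eq N D S hD]
  have hpos : (0 : ℝ) < D * 2 ^ S := by
    have : (0 : ℝ) < D := by exact_mod_cast hD
    positivity
  have hlo : (Nat.sqrt M : ℝ) ≤ √(M : ℝ) :=
    Real.le_sqrt_of_sq_le (by exact_mod_cast Nat.sqrt_le' M)
  have hhi : √(M : ℝ) ≤ (Nat.sqrt M : ℝ) + 1 :=
    (Real.sqrt_le_left (by positivity)).2 (by exact_mod_cast (Nat.lt_succ_sqrt' M).le)
  refine ⟨?_, ?_, fun hsq => ?_⟩
  · rw [hnorm]; exact div_le_div_of_nonneg_right hlo hpos.le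
  · rw [hnorm]; exact div_le_div_of_nonneg_right hhi hpos.le
  · rw [hnorm]
    congr 1
    rw [show (M : ℝ) = ((Nat.sqrt M : ℕ) : ℝ) ^ 2 by exact_mod_cast hsq.symm]
    exact Real.sqrt_sq (Nat.cast_nonneg _)

end Sqrt

/-! ### Real polynomials: conjugate roots and real-root tagging -/

section RealRoots

/-- **The non-real zeros of a real polynomial come in conjugate pairs**: the multiset of complex
roots of `q ∈ ℝ[X]` is invariant under complex conjugation (multiplicities included).
[cite: BorweinErdelyi1995, §1.1 E.8] -/
theorem roots_map_conj (q : ℝ[X]) :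
    (q.map (algebraMap ℝ ℂ)).roots.map (starRingEnd ℂ) = (q.map (algebraMap ℝ ℂ)).roots := by
  have hc : (starRingEnd ℂ).comp (algebraMap ℝ ℂ) = algebraMap ℝ ℂ := by
    ext x
    simp
  rw [roots_map_of_injective_of_card_eq_natDegree (starRingEnd ℂ).injective
      IsAlgClosed.card_roots_eq_natDegree, Polynomial.map_map, hc]

/-- **Real-root tagging.** If a disc with *real* centre `c` contains exactly one complex root of
the real polynomial `q` (counted with multiplicity) — e.g. certified by `pellet_one` — then that
root is real: it is `x ∈ ℝ` with `|x - c| < r` and `q(x) = 0`, and every complex root of `q` in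
the disc equals `x`. (The disc is symmetric under conjugation and so is the root multiset, so the
unique root is its own conjugate.) [cite: BorweinErdelyi1995, §1.1 E.8] -/
theorem exists_real_root_of_card_eq_one (q : ℝ[X]) (c r : ℝ)
    (h : Multiset.card ((q.map (algebraMap ℝ ℂ)).roots.filter
      fun ζ : ℂ => ‖ζ - (c : ℂ)‖ < r) = 1) :
    ∃ x : ℝ, |x - c| < r ∧ q.IsRoot x ∧
      ∀ ζ ∈ (q.map (algebraMap ℝ ℂ)).roots, ‖ζ - (c : ℂ)‖ < r → ζ = (x : ℂ) := by
  obtain ⟨ζ, hζ⟩ := Multiset.card_eq_one.1 h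
  have hmem : ∀ ξ : ℂ, ξ ∈ (q.map (algebraMap ℝ ℂ)).roots ∧ ‖ξ - (c : ℂ)‖ < r ↔ ξ = ζ := by
    intro ξ
    constructor
    · rintro ⟨h1, h2⟩
      have hξ : ξ ∈ (q.map (algebraMap ℝ ℂ)).roots.filter fun ζ : ℂ => ‖ζ - (c : ℂ)‖ < r :=
        Multiset.mem_filter.2 ⟨h1, h2⟩
      rw [hζ] at hξ
      exact Multiset.mem_singleton.1 hξ
    · rintro rfl
      have hξ : ξ ∈ (q.map (algebraMap ℝ ℂ)).roots.filter fun ζ : ℂ => ‖ζ - (c : ℂ)‖ < r := by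
        rw [hζ]
        exact Multiset.mem_singleton_self _
      exact Multiset.mem_filter.1 hξ
  obtain ⟨hζroot, hζlt⟩ := (hmem ζ).2 rfl
  have hconj : (starRingEnd ℂ) ζ = ζ := by
    refine (hmem _).1 ⟨?_, ?_⟩
    · rw [← roots_map_conj q]
      exact Multiset.mem_map_of_mem _ hζroot
    · rw [← Complex.conj_ofReal c, ← map_sub, Complex.norm_conj]
      exact hζlt
  obtain ⟨x, rfl⟩ : ∃ x : ℝ, (x : ℂ) = ζ := ⟨ζ.re, Complex.conj_eq_iff_re.1 hconj⟩
  have hP0 : q.map (algebraMap ℝ ℂ) ≠ 0 := fun h0 => by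
    rw [h0, roots_zero] at hζroot
    exact Multiset.notMem_zero _ hζroot
  refine ⟨x, ?_, ?_, fun ξ hξ hξr => (hmem ξ).1 ⟨hξ, hξr⟩⟩
  · rw [← Complex.ofReal_sub, Complex.norm_real, Real.norm_eq_abs] at hζlt
    exact hζlt
  · have hx : IsRoot (q.map (algebraMap ℝ ℂ)) (algebraMap ℝ ℂ x) := (mem_roots hP0).1 hζroot
    exact hx.of_map (algebraMap ℝ ℂ).injective

end RealRoots

/-! ### Completeness: separated discs account for all the roots -/

section Completeness

/-- **All roots found.** Let `p ∈ ℂ[X]`, `p ≠ 0`, and let `(Δᵢ)_{i ∈ s}` be open discs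
`‖z - cᵢ‖ < rᵢ` that are pairwise separated (`rᵢ + rⱼ ≤ ‖cᵢ - cⱼ‖`, hence disjoint), each
containing at least one root of `p`, with `#s ≥ deg p`. Since `p` has exactly `deg p` roots
counted with multiplicity, pigeonhole gives: every root of `p` lies in some `Δᵢ`, each `Δᵢ`
contains exactly one root, it is simple, and `#s = deg p`. This is the final check that turns a
list of certified isolating discs into a certified complete root list.
[cite: BorweinErdelyi1995, §1.2 Thm. 1.2.1] -/
theorem roots_covered_of_separated {ι : Type*} (s : Finset ι) (c : ι → ℂ) (r : ι → ℝ)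
    {p : ℂ[X]} (hp : p ≠ 0)
    (hsep : ∀ i ∈ s, ∀ j ∈ s, i ≠ j → r i + r j ≤ ‖c i - c j‖)
    (hone : ∀ i ∈ s, 1 ≤ Multiset.card (p.roots.filter fun ζ => ‖ζ - c i‖ < r i))
    (hdeg : p.natDegree ≤ s.card) :
    (∀ ζ ∈ p.roots, ∃ i ∈ s, ‖ζ - c i‖ < r i) ∧
      (∀ i ∈ s, Multiset.card (p.roots.filter fun ζ => ‖ζ - c i‖ < r i) = 1) ∧
      p.natDegree = s.card := by
  classical
  have _ := hp
  -- two separated discs have no common point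
  have hdisj : ∀ i ∈ s, ∀ j ∈ s, i ≠ j → ∀ ζ : ℂ, ‖ζ - c i‖ < r i → ¬ ‖ζ - c j‖ < r j := by
    intro i hi j hj hij ζ hζi hζj
    have h1 := hsep i hi j hj hij
    have h2 : ‖c i - c j‖ ≤ ‖ζ - c i‖ + ‖ζ - c j‖ :=
      calc ‖c i - c j‖ = ‖(ζ - c j) - (ζ - c i)‖ := by congr 1; ring
        _ ≤ ‖ζ - c j‖ + ‖ζ - c i‖ := norm_sub_le _ _
        _ = ‖ζ - c i‖ + ‖ζ - c j‖ := add_comm _ _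
    linarith
  -- the counts add up to the count of the union
  have hsum : ∀ t : Finset ι, t ⊆ s →
      ∑ i ∈ t, Multiset.card (p.roots.filter fun ζ => ‖ζ - c i‖ < r i) =
        Multiset.card (p.roots.filter fun ζ => ∃ i ∈ t, ‖ζ - c i‖ < r i) := by
    intro t ht
    induction t using Finset.induction_on with
    | empty => simp
    | insert a t hat ih =>
      rw [sum_insert hat, ih ((Finset.subset_insert a t).trans ht), ← Multiset.card_add,
        Multiset.filter_add_filter]
      have hand : (p.roots.filter fun ζ => ‖ζ - c a‖ < r a ∧ ∃ i ∈ t, ‖ζ - c i‖ < r i) = 0 := by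
        refine Multiset.filter_eq_nil.2 fun ζ _ hζ => ?_
        obtain ⟨ha, i, hi, hζi⟩ := hζ
        exact hdisj a (ht (mem_insert_self a t)) i (ht (mem_insert_of_mem hi))
          (fun h => hat (h ▸ hi)) ζ ha hζi
      rw [hand, add_zero]
      congr 1
      exact Multiset.filter_congr fun ζ _ => by simp
  have hU : Multiset.card (p.roots.filter fun ζ => ∃ i ∈ s, ‖ζ - c i‖ < r i) ≤ p.natDegree :=
    (Multiset.card_le_card (Multiset.filter_le _ _)).trans_eq IsAlgClosed.card_roots_eq_natDegree
  have hS := hsum s (Finset.Subset.refl s)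
  have hge : s.card ≤ ∑ i ∈ s, Multiset.card (p.roots.filter fun ζ => ‖ζ - c i‖ < r i) := by
    rw [card_eq_sum_ones]
    exact sum_le_sum fun i hi => hone i hi
  have hdeg' : p.natDegree = s.card := le_antisymm hdeg (hge.trans (hS ▸ hU))
  have h1 : ∑ i ∈ s, Multiset.card (p.roots.filter fun ζ => ‖ζ - c i‖ < r i) = s.card :=
    le_antisymm (hS ▸ hU.trans hdeg) hge
  refine ⟨fun ζ hζ => ?_, fun i hi => ?_, hdeg'⟩
  · have hUeq : (p.roots.filter fun ζ => ∃ i ∈ s, ‖ζ - c i‖ < r i) = p.roots :=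
      Multiset.eq_of_le_of_card_le (Multiset.filter_le _ _)
        (by rw [← hS, h1, ← hdeg']; exact IsAlgClosed.card_roots_eq_natDegree.le)
    rw [← hUeq] at hζ
    exact (Multiset.mem_filter.1 hζ).2
  · by_contra hne
    have h2 : 2 ≤ Multiset.card (p.roots.filter fun ζ => ‖ζ - c i‖ < r i) := by
      have := hone i hi
      omega
    have hrest : (s.erase i).card ≤
        ∑ j ∈ s.erase i, Multiset.card (p.roots.filter fun ζ => ‖ζ - c j‖ < r j) := by
      rw [card_eq_sum_ones]
      exact sum_le_sum fun j hj => hone j (mem_of_mem_erase hj)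
    have hsplit := add_sum_erase s
      (fun j => Multiset.card (p.roots.filter fun ζ => ‖ζ - c j‖ < r j)) hi
    have hcard := card_erase_of_mem hi
    omega

end Completeness

end Literature.Analysis.Complex.Pellet
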